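import Mathlib.RingTheory.Flat.TorsionFree
import Mathlib.RingTheory.Flat.Localization
import Literature.AlgebraicGeometry.Motives.FaltingsAbelian
import Literature.AlgebraicGeometry.Motives.TateAbelianFiniteSteps
import Literature.NumberTheory.DiophantineGeometry.AVGaloisModuleContinuityProofs
import Literature.NumberTheory.DiophantineGeometry.AVIsogenyTateHoldsProofs
import Literature.RepresentationTheory.IntertwiningMapBaseChange
import HarnessLib

/-!
# Rational Faltings: `ℚ_ℓ ⊗_ℤ Hom_K(A, B) ≅ Hom_{Γ_K}(V_ℓ A, V_ℓ B)` from the integral Tate map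

Proof-lane file for `Literature.AlgebraicGeometry.Motives.FaltingsAbelian` (no named fact, no `sorry`; D-0026).

Faltings' theorem (Invent. Math. 73 (1983), §5, Satz 4 / Korollar 1; the tree's named fact `faltings_tate_bijective A B ℓ`)
says that for abelian varieties `A, B` over a number field `K` the Tate map
`ℤ_ℓ ⊗_ℤ Hom_K(A, B) → Hom_{Γ_K}(T_ℓ A, T_ℓ B)`, `c ⊗ f ↦ c • T_ℓ f` (`AbelianVariety.faltingsTateMap`) is bijective.  Its RATIONAL
form — the one quoted as "Faltings isotypic" in arguments about `V_ℓ = ℚ_ℓ ⊗_{ℤ_ℓ} T_ℓ` (e.g. Liu, arXiv:2102.11518, proof of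
Thm. 4.18) — is

  `ℚ_ℓ ⊗_ℤ Hom_K(A, B) → Hom_{Γ_K}(V_ℓ A, V_ℓ B)`, `c ⊗ f ↦ c • V_ℓ f`, is bijective   (`faltings_rationalTate_bijective_of`),

where `V_ℓ A = A.rationalTateModule ℓ = ℚ_ℓ ⊗_{ℤ_ℓ} T_ℓ A` with `Γ_K` acting through `A.rationalTateRep ℓ = 1 ⊗ ρ_{A,ℓ}`, and
`V_ℓ f = 1 ⊗ T_ℓ f`.  PROOF: `ℚ_ℓ ⊗_ℤ Hom = ℚ_ℓ ⊗_{ℤ_ℓ} (ℤ_ℓ ⊗_ℤ Hom)` (Mathlib `cancelBaseChange`)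
`≅ ℚ_ℓ ⊗_{ℤ_ℓ} Hom_{Γ_K}(T_ℓ A, T_ℓ B)` (Faltings, `⊗ ℚ_ℓ`) `≅ Hom_{Γ_K}(V_ℓ A, V_ℓ B)` — the last step is «intertwiners commute with
flat base change» (`Literature.RepresentationTheory.IntertwiningBaseChange.intertwiningBaseChangeEquiv` at `ℤ_ℓ → ℚ_ℓ`: `ℚ_ℓ` is
flat over the PID `ℤ_ℓ`, `T_ℓ A`, `T_ℓ B` are finite free `ℤ_ℓ`-modules for `ℓ ≠ char K` — tree theorems
`AbelianVariety.module_free_tateModule_holds`, `module_finite_tateModule_of_cast_ne_zero`), and the composite IS `c ⊗ f ↦ c • V_ℓ f`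
(checked on pure tensors).

* `AbelianVariety.rationalTateHom A B ℓ = Hom_{Γ_K}(V_ℓ A, V_ℓ B)` (Mathlib `Representation.IntertwiningMap`);
* `AbelianVariety.rationalTateIntertwiningMap ℓ f = V_ℓ f` as an element of it, `toLinearMap_rationalTateIntertwiningMap`;
* `AbelianVariety.faltingsRationalTateMap A B ℓ : ℚ_[ℓ] ⊗[ℤ] (A ⟶ B) →ₗ[ℚ_[ℓ]] rationalTateHom A B ℓ`, `faltingsRationalTateMap_tmul`;
* `repBaseChange_tateRep : repBaseChange ℚ_[ℓ] (A.tateRep ℓ) = A.rationalTateRep ℓ` (`rfl`: the two extension-of-scalars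
  constructions agree definitionally);
* **`faltings_rationalTate_bijective_of (h : faltings_tate_bijective A B ℓ) [NumberField K] : Bijective (faltingsRationalTateMap A B ℓ)`**
  and the characteristic-free form `faltingsRationalTateMap_bijective_of_bijective` (any field with `(ℓ : K) ≠ 0`, from
  bijectivity of the integral Tate map).

Consumer: cell hodgecm-mathlib, line `a3-liu418` v3, step S_F (gap (g1) of B-typ04's VI-1 check, 2026-08-28).

References: [Faltings1983Endlichkeit] §5 Satz 4, Korollar 1 (and Korollar 2's proof, which passes to `⊗ ℚ_l`);
[Bourbaki1989CommAlg] Ch. I §2 no. 10 Prop. 11 (Hom and flat base change).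
-/

noncomputable section

universe u

open scoped TensorProduct

namespace Literature.AlgebraicGeometry.Motives

open AbelianVariety Literature.RepresentationTheory.IntertwiningBaseChange

variable {K : Type u} [Field K] (A B : AbelianVariety K) (ℓ : ℕ) [Fact ℓ.Prime]

/-- **`Hom_{Γ_K}(V_ℓ A, V_ℓ B)`**: `ℚ_ℓ`-linear maps `V_ℓ A → V_ℓ B` commuting with `Γ_K` (Mathlib `Representation.IntertwiningMap`
of the rational Tate representations). [cite: Faltings1983Endlichkeit, §5 Korollar 2] -/
abbrev _root_.Literature.AlgebraicGeometry.Motives.AbelianVariety.rationalTateHom : Type u :=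
  (A.rationalTateRep ℓ).IntertwiningMap (B.rationalTateRep ℓ)

/-- The two extensions of scalars agree DEFINITIONALLY: `repBaseChange ℚ_ℓ ρ_{A,ℓ} = A.rationalTateRep ℓ` (both are
`Module.End.baseChangeHom ∘ ρ`). [cite: Faltings1983Endlichkeit, §5] -/
theorem _root_.Literature.AlgebraicGeometry.Motives.AbelianVariety.repBaseChange_tateRep :
    repBaseChange ℚ_[ℓ] (A.tateRep ℓ) = A.rationalTateRep ℓ :=
  rfl

variable {A B} in
/-- **`V_ℓ f = 1 ⊗ T_ℓ f ∈ Hom_{Γ_K}(V_ℓ A, V_ℓ B)`** for `f : A → B`. [cite: Faltings1983Endlichkeit, §5] -/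
def _root_.Literature.AlgebraicGeometry.Motives.AbelianVariety.rationalTateIntertwiningMap (f : A ⟶ B) : rationalTateHom A B ℓ where
  toLinearMap := (tateModuleMap ℓ f).baseChange ℚ_[ℓ]
  isIntertwining' g :=
    baseChange_mem ℚ_[ℓ] (A.tateRep ℓ) (B.tateRep ℓ) (tateModuleMap ℓ f) (tateIntertwiningMap ℓ f).isIntertwining' g

variable {A B} in
/-- underlying linear map of `V_ℓ f`. [cite: Faltings1983Endlichkeit, §5] -/
@[simp]
theorem _root_.Literature.AlgebraicGeometry.Motives.AbelianVariety.toLinearMap_rationalTateIntertwiningMap (f : A ⟶ B) :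
    (rationalTateIntertwiningMap ℓ f).toLinearMap = (tateModuleMap ℓ f).baseChange ℚ_[ℓ] :=
  rfl

/-- `f ↦ V_ℓ f` is additive. [cite: Faltings1983Endlichkeit, §5] -/
def _root_.Literature.AlgebraicGeometry.Motives.AbelianVariety.homToRationalTate : (A ⟶ B) →+ rationalTateHom A B ℓ :=
  AddMonoidHom.mk' (rationalTateIntertwiningMap ℓ) fun f g => Representation.IntertwiningMap.ext (by
    have h := congrArg (fun φ : tateHom A B ℓ => φ.toLinearMap.baseChange ℚ_[ℓ]) (map_add (homToTate A B ℓ) f g)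
    simp only [homToTate_apply, toLinearMap_tateIntertwiningMap, Representation.IntertwiningMap.add_toLinearMap,
      LinearMap.baseChange_add] at h
    rw [Representation.IntertwiningMap.add_toLinearMap, toLinearMap_rationalTateIntertwiningMap,
      toLinearMap_rationalTateIntertwiningMap, toLinearMap_rationalTateIntertwiningMap]
    exact h)

/-- `homToRationalTate A B ℓ f = V_ℓ f`. [cite: Faltings1983Endlichkeit, §5] -/
@[simp]
theorem _root_.Literature.AlgebraicGeometry.Motives.AbelianVariety.homToRationalTate_apply (f : A ⟶ B) :
    homToRationalTate A B ℓ f = rationalTateIntertwiningMap ℓ f :=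
  rfl

/-- **The rational Tate map** `ℚ_ℓ ⊗_ℤ Hom_K(A, B) →ₗ[ℚ_ℓ] Hom_{Γ_K}(V_ℓ A, V_ℓ B)`, `c ⊗ f ↦ c • V_ℓ f` (same construction as
`faltingsTateMap`). [cite: Faltings1983Endlichkeit, §5 Korollar 1] -/
def _root_.Literature.AlgebraicGeometry.Motives.AbelianVariety.faltingsRationalTateMap :
    ℚ_[ℓ] ⊗[ℤ] (A ⟶ B) →ₗ[ℚ_[ℓ]] rationalTateHom A B ℓ :=
  TensorProduct.AlgebraTensorModule.lift
    (((LinearMap.lsmul ℚ_[ℓ] (rationalTateHom A B ℓ)).flip.restrictScalars ℤ ∘ₗ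
      (homToRationalTate A B ℓ).toIntLinearMap).flip)

variable {A B} in
/-- `faltingsRationalTateMap` on pure tensors: `c ⊗ f ↦ c • V_ℓ f`. [cite: Faltings1983Endlichkeit, §5 Korollar 1] -/
@[simp]
theorem _root_.Literature.AlgebraicGeometry.Motives.AbelianVariety.faltingsRationalTateMap_tmul (c : ℚ_[ℓ]) (f : A ⟶ B) :
    faltingsRationalTateMap A B ℓ (c ⊗ₜ[ℤ] f) = c • rationalTateIntertwiningMap ℓ f :=
  rfl

/-- **Rational Faltings from the integral Tate map, characteristic-free form**: if `(ℓ : K) ≠ 0` and the integral Tate map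
`ℤ_ℓ ⊗ Hom_K(A, B) → Hom_{Γ_K}(T_ℓ A, T_ℓ B)` is bijective, then so is the rational one
`ℚ_ℓ ⊗ Hom_K(A, B) → Hom_{Γ_K}(V_ℓ A, V_ℓ B)`.  (`ℚ_ℓ` is flat over `ℤ_ℓ`; `T_ℓ A`, `T_ℓ B` are finite free; intertwiners commute
with flat base change.) [cite: Faltings1983Endlichkeit, §5 Korollar 1 and proof of Korollar 2] -/
theorem _root_.Literature.AlgebraicGeometry.Motives.AbelianVariety.faltingsRationalTateMap_bijective_of_bijective
    (hℓ : (ℓ : K) ≠ 0) (h : Function.Bijective (faltingsTateMap A B ℓ)) :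
    Function.Bijective (faltingsRationalTateMap A B ℓ) := by
  haveI : Module.Free ℤ_[ℓ] (A.tateModule ℓ) := module_free_tateModule_holds A ℓ hℓ
  haveI : Module.Finite ℤ_[ℓ] (A.tateModule ℓ) := module_finite_tateModule_of_cast_ne_zero A ℓ hℓ
  haveI : Module.Finite ℤ_[ℓ] (B.tateModule ℓ) := module_finite_tateModule_of_cast_ne_zero B ℓ hℓ
  -- the chain of `ℚ_ℓ`-linear equivalences
  let E0 : ℚ_[ℓ] ⊗[ℤ] (A ⟶ B) ≃ₗ[ℚ_[ℓ]] ℚ_[ℓ] ⊗[ℤ_[ℓ]] (ℤ_[ℓ] ⊗[ℤ] (A ⟶ B)) :=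
    (TensorProduct.AlgebraTensorModule.cancelBaseChange ℤ ℤ_[ℓ] ℚ_[ℓ] ℚ_[ℓ] (A ⟶ B)).symm
  let E1 : ℚ_[ℓ] ⊗[ℤ_[ℓ]] (ℤ_[ℓ] ⊗[ℤ] (A ⟶ B)) ≃ₗ[ℚ_[ℓ]] ℚ_[ℓ] ⊗[ℤ_[ℓ]] tateHom A B ℓ :=
    LinearEquiv.baseChange ℤ_[ℓ] ℚ_[ℓ] _ _ (LinearEquiv.ofBijective (faltingsTateMap A B ℓ) h)
  let E2 : ℚ_[ℓ] ⊗[ℤ_[ℓ]] tateHom A B ℓ ≃ₗ[ℚ_[ℓ]]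
      ℚ_[ℓ] ⊗[ℤ_[ℓ]] intertwiningSubmodule (A.tateRep ℓ) (B.tateRep ℓ) :=
    LinearEquiv.baseChange ℤ_[ℓ] ℚ_[ℓ] _ _ (intertwiningSubmoduleEquiv (A.tateRep ℓ) (B.tateRep ℓ)).symm
  let E3 : ℚ_[ℓ] ⊗[ℤ_[ℓ]] intertwiningSubmodule (A.tateRep ℓ) (B.tateRep ℓ) ≃ₗ[ℚ_[ℓ]]
      intertwiningSubmodule (repBaseChange ℚ_[ℓ] (A.tateRep ℓ)) (repBaseChange ℚ_[ℓ] (B.tateRep ℓ)) :=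
    intertwiningBaseChangeEquiv ℚ_[ℓ] (A.tateRep ℓ) (B.tateRep ℓ)
  let E4 : intertwiningSubmodule (repBaseChange ℚ_[ℓ] (A.tateRep ℓ)) (repBaseChange ℚ_[ℓ] (B.tateRep ℓ)) ≃ₗ[ℚ_[ℓ]]
      rationalTateHom A B ℓ :=
    intertwiningSubmoduleEquiv (A.rationalTateRep ℓ) (B.rationalTateRep ℓ)
  let E : ℚ_[ℓ] ⊗[ℤ] (A ⟶ B) ≃ₗ[ℚ_[ℓ]] rationalTateHom A B ℓ := E0 ≪≫ₗ E1 ≪≫ₗ E2 ≪≫ₗ E3 ≪≫ₗ E4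
  -- the composite IS the rational Tate map
  have hE : (E : ℚ_[ℓ] ⊗[ℤ] (A ⟶ B) →ₗ[ℚ_[ℓ]] rationalTateHom A B ℓ) = faltingsRationalTateMap A B ℓ := by
    apply TensorProduct.AlgebraTensorModule.ext
    intro c f
    apply Representation.IntertwiningMap.ext
    rw [faltingsRationalTateMap_tmul, Representation.IntertwiningMap.toLinearMap_smul, toLinearMap_rationalTateIntertwiningMap]
    simp only [E, E0, E1, E2, E4, LinearEquiv.coe_coe, LinearEquiv.trans_apply,
      TensorProduct.AlgebraTensorModule.cancelBaseChange_symm_tmul, LinearEquiv.baseChange_tmul,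
      LinearEquiv.ofBijective_apply, faltingsTateMap_tmul, one_smul, homToTate_apply]
    change (intertwiningBaseChangeEquiv ℚ_[ℓ] (A.tateRep ℓ) (B.tateRep ℓ)
      (c ⊗ₜ[ℤ_[ℓ]] (intertwiningSubmoduleEquiv (A.tateRep ℓ) (B.tateRep ℓ)).symm (tateIntertwiningMap ℓ f))).1 =
        c • (tateModuleMap ℓ f).baseChange ℚ_[ℓ]
    rw [intertwiningBaseChangeEquiv_tmul_val]
    rfl
  rw [← hE]
  exact E.bijective

/-- **Rational Faltings** (Faltings 1983, §5, Korollar 1 tensored with `ℚ_l`, as used in the proof of Korollar 2): for abelian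
varieties `A, B` over a number field `K` and any prime `ℓ`, the rational Tate map
`ℚ_ℓ ⊗_ℤ Hom_K(A, B) → Hom_{Γ_K}(V_ℓ A, V_ℓ B)`, `c ⊗ f ↦ c • V_ℓ f`, is bijective — granted the named fact
`faltings_tate_bijective A B ℓ` (hypothesis `h`). [cite: Faltings1983Endlichkeit, §5 Korollar 1 and proof of Korollar 2] -/
theorem faltings_rationalTate_bijective_of (h : faltings_tate_bijective A B ℓ) [NumberField K] :
    Function.Bijective (faltingsRationalTateMap A B ℓ) :=
  faltingsRationalTateMap_bijective_of_bijective A B ℓ (natCast_ne_zero_of_numberField ℓ) h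

/-- The `ℚ_ℓ`-linear EQUIVALENCE `ℚ_ℓ ⊗_ℤ Hom_K(A, B) ≃ Hom_{Γ_K}(V_ℓ A, V_ℓ B)` packaged from `faltings_rationalTate_bijective_of`.
[cite: Faltings1983Endlichkeit, §5 Korollar 1 and proof of Korollar 2] -/
def faltingsRationalTateEquiv_of (h : faltings_tate_bijective A B ℓ) [NumberField K] :
    ℚ_[ℓ] ⊗[ℤ] (A ⟶ B) ≃ₗ[ℚ_[ℓ]] rationalTateHom A B ℓ :=
  LinearEquiv.ofBijective (faltingsRationalTateMap A B ℓ) (faltings_rationalTate_bijective_of A B ℓ h)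

/-- `faltingsRationalTateEquiv_of h (c ⊗ f) = c • V_ℓ f`. [cite: Faltings1983Endlichkeit, §5 Korollar 1] -/
@[simp]
theorem faltingsRationalTateEquiv_of_tmul (h : faltings_tate_bijective A B ℓ) [NumberField K] (c : ℚ_[ℓ]) (f : A ⟶ B) :
    faltingsRationalTateEquiv_of A B ℓ h (c ⊗ₜ[ℤ] f) = c • rationalTateIntertwiningMap ℓ f :=
  rfl

/-! ## Injectivity without Faltings, the span form, linear independence, ranks

Consumer shapes for the `a3-liu418` line, step S_F ("Faltings isotypic"), cell hodgecm-mathlib (INBOX 2026-08-28T02:27:55Z):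

* `AbelianVariety.faltingsRationalTateMap_injective` — **unconditional** (any field with `(ℓ : K) ≠ 0`): the rational Tate map
  `ℚ_ℓ ⊗_ℤ Hom_K(A, B) → Hom_{Γ_K}(V_ℓ A, V_ℓ B)` is injective (Mumford §19 Thm. 3 — the tree's theorem
  `faltingsTateMap_injective_holds` — tensored with the flat `ℤ_ℓ`-module `ℚ_ℓ`);
* `AbelianVariety.linearIndependent_rationalTateModuleMap_hom_of_linearIndependent_int` — `ℤ`-independent `f_i : A → B` have
  `ℚ_ℓ`-independent `V_ℓ f_i` (the `Hom` version of the `End`-only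
  `AbelianVariety.linearIndependent_rationalTateModuleMap_of_linearIndependent_int` of `TateModuleOfCMFreeRankOne`, without a
  finiteness assumption on the index type);
* `mem_span_range_rationalTateModuleMap_of_faltings_tate_bijective` — granted `faltings_tate_bijective A B ℓ`, every
  `Γ_K`-equivariant `ℚ_ℓ`-linear `g : V_ℓ A → V_ℓ B` lies in the `ℚ_ℓ`-span of the `V_ℓ f`, `f ∈ Hom_K(A, B)` (rational analogue of
  `mem_span_range_tateModuleMap_of_faltings_tate_bijective`);
* `AbelianVariety.module_finite_rationalTateHom`, `finrank_rationalTateHom_eq_of` — `Hom_{Γ_K}(V_ℓ A, V_ℓ B)` is finite-dimensional and,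
  granted Faltings, `dim_{ℚ_ℓ} Hom_{Γ_K}(V_ℓ A, V_ℓ B) = rank_ℤ Hom_K(A, B)` (`Hom_K(A, B)` is finite free: tree theorems
  `module_free_hom_holds`, `module_finite_hom_holds`). -/

section Consequences

/-- **Mumford §19 Thm. 3 ⊗ `ℚ_ℓ`, `Hom` form: the rational Tate map `ℚ_ℓ ⊗_ℤ Hom_K(A, B) → Hom_{Γ_K}(V_ℓ A, V_ℓ B)` is injective**
for every prime `ℓ` invertible in `K` — NO Faltings hypothesis.  Proof: it factors as
`ℚ_ℓ ⊗_ℤ Hom = ℚ_ℓ ⊗_{ℤ_ℓ} (ℤ_ℓ ⊗_ℤ Hom) → ℚ_ℓ ⊗_{ℤ_ℓ} Hom_{Γ_K}(T_ℓ A, T_ℓ B) ≅ Hom_{Γ_K}(V_ℓ A, V_ℓ B)`, the middle arrow being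
`ℚ_ℓ ⊗_{ℤ_ℓ}`(the integral Tate map), injective because the integral Tate map is (`faltingsTateMap_injective_holds`, Mumford §19
Thm. 3 / Milne 1986 Thm. 12.5) and `ℚ_ℓ` is flat over `ℤ_ℓ`; the last isomorphism is «intertwiners commute with flat base change»
(`intertwiningBaseChangeEquiv`). [cite: MumfordAV1970, §19 Thm. 3] -/
theorem _root_.Literature.AlgebraicGeometry.Motives.AbelianVariety.faltingsRationalTateMap_injective (hℓ : (ℓ : K) ≠ 0) :
    Function.Injective (faltingsRationalTateMap A B ℓ) := by
  haveI : Module.Free ℤ_[ℓ] (A.tateModule ℓ) := module_free_tateModule_holds A ℓ hℓ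
  haveI : Module.Finite ℤ_[ℓ] (A.tateModule ℓ) := module_finite_tateModule_of_cast_ne_zero A ℓ hℓ
  haveI : Module.Finite ℤ_[ℓ] (B.tateModule ℓ) := module_finite_tateModule_of_cast_ne_zero B ℓ hℓ
  let E0 : ℚ_[ℓ] ⊗[ℤ] (A ⟶ B) ≃ₗ[ℚ_[ℓ]] ℚ_[ℓ] ⊗[ℤ_[ℓ]] (ℤ_[ℓ] ⊗[ℤ] (A ⟶ B)) :=
    (TensorProduct.AlgebraTensorModule.cancelBaseChange ℤ ℤ_[ℓ] ℚ_[ℓ] ℚ_[ℓ] (A ⟶ B)).symm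
  let T : ℚ_[ℓ] ⊗[ℤ_[ℓ]] (ℤ_[ℓ] ⊗[ℤ] (A ⟶ B)) →ₗ[ℚ_[ℓ]] ℚ_[ℓ] ⊗[ℤ_[ℓ]] tateHom A B ℓ :=
    (faltingsTateMap A B ℓ).baseChange ℚ_[ℓ]
  let E2 : ℚ_[ℓ] ⊗[ℤ_[ℓ]] tateHom A B ℓ ≃ₗ[ℚ_[ℓ]]
      ℚ_[ℓ] ⊗[ℤ_[ℓ]] intertwiningSubmodule (A.tateRep ℓ) (B.tateRep ℓ) :=
    LinearEquiv.baseChange ℤ_[ℓ] ℚ_[ℓ] _ _ (intertwiningSubmoduleEquiv (A.tateRep ℓ) (B.tateRep ℓ)).symm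
  let E3 : ℚ_[ℓ] ⊗[ℤ_[ℓ]] intertwiningSubmodule (A.tateRep ℓ) (B.tateRep ℓ) ≃ₗ[ℚ_[ℓ]]
      intertwiningSubmodule (repBaseChange ℚ_[ℓ] (A.tateRep ℓ)) (repBaseChange ℚ_[ℓ] (B.tateRep ℓ)) :=
    intertwiningBaseChangeEquiv ℚ_[ℓ] (A.tateRep ℓ) (B.tateRep ℓ)
  let E4 : intertwiningSubmodule (repBaseChange ℚ_[ℓ] (A.tateRep ℓ)) (repBaseChange ℚ_[ℓ] (B.tateRep ℓ)) ≃ₗ[ℚ_[ℓ]]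
      rationalTateHom A B ℓ :=
    intertwiningSubmoduleEquiv (A.rationalTateRep ℓ) (B.rationalTateRep ℓ)
  let F : ℚ_[ℓ] ⊗[ℤ] (A ⟶ B) →ₗ[ℚ_[ℓ]] rationalTateHom A B ℓ :=
    E4.toLinearMap ∘ₗ E3.toLinearMap ∘ₗ E2.toLinearMap ∘ₗ T ∘ₗ E0.toLinearMap
  -- the composite IS the rational Tate map
  have hF : F = faltingsRationalTateMap A B ℓ := by
    apply TensorProduct.AlgebraTensorModule.ext
    intro c f
    apply Representation.IntertwiningMap.ext
    rw [faltingsRationalTateMap_tmul, Representation.IntertwiningMap.toLinearMap_smul, toLinearMap_rationalTateIntertwiningMap]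
    simp only [F, E0, T, E2, E4, LinearMap.coe_comp, Function.comp_apply, LinearEquiv.coe_coe,
      TensorProduct.AlgebraTensorModule.cancelBaseChange_symm_tmul, LinearMap.baseChange_tmul, LinearEquiv.baseChange_tmul,
      faltingsTateMap_tmul, one_smul, homToTate_apply]
    change (intertwiningBaseChangeEquiv ℚ_[ℓ] (A.tateRep ℓ) (B.tateRep ℓ)
      (c ⊗ₜ[ℤ_[ℓ]] (intertwiningSubmoduleEquiv (A.tateRep ℓ) (B.tateRep ℓ)).symm (tateIntertwiningMap ℓ f))).1 =
        c • (tateModuleMap ℓ f).baseChange ℚ_[ℓ]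
    rw [intertwiningBaseChangeEquiv_tmul_val]
    rfl
  -- the middle arrow is injective by flatness of `ℚ_ℓ` over `ℤ_ℓ`
  have hT : Function.Injective T := by
    change Function.Injective ((faltingsTateMap A B ℓ).baseChange ℚ_[ℓ])
    rw [LinearMap.baseChange_eq_ltensor]
    exact Module.Flat.lTensor_preserves_injective_linearMap _ (faltingsTateMap_injective_holds A B ℓ hℓ)
  rw [← hF]
  exact E4.injective.comp (E3.injective.comp (E2.injective.comp (hT.comp E0.injective)))

/-- Over a number field the rational Tate map `ℚ_ℓ ⊗_ℤ Hom_K(A, B) → Hom_{Γ_K}(V_ℓ A, V_ℓ B)` is injective for every prime `ℓ`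
(`faltingsRationalTateMap_injective` with `char K = 0`). [cite: MumfordAV1970, §19 Thm. 3] -/
theorem _root_.Literature.AlgebraicGeometry.Motives.AbelianVariety.faltingsRationalTateMap_injective_of_numberField [NumberField K] :
    Function.Injective (faltingsRationalTateMap A B ℓ) :=
  faltingsRationalTateMap_injective A B ℓ (natCast_ne_zero_of_numberField ℓ)

variable {A B} in
/-- **`ℤ`-independent homomorphisms `f_i : A → B` have `ℚ_ℓ`-independent `V_ℓ f_i`** (`ℓ` invertible in `K`; any index type):
`f ↦ 1 ⊗ f`, `Hom_K(A, B) → ℚ_ℓ ⊗_ℤ Hom_K(A, B)`, preserves independence (`ℚ_ℓ` is flat over `ℤ`, Mathlib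
`Module.Flat.linearIndependent_one_tmul`), the rational Tate map is injective (`faltingsRationalTateMap_injective`), and
`IntertwiningMap.toLinearMap` is injective and linear.  (`Hom` version of the `End`-only
`AbelianVariety.linearIndependent_rationalTateModuleMap_of_linearIndependent_int`; Serre–Tate 1968, proof of Thm. 5:
«the map `ℚ_l ⊗ Hom(A, B) → Hom(V_l A, V_l B)` is injective (Weil)».) [cite: MumfordAV1970, §19 Thm. 3] -/
theorem _root_.Literature.AlgebraicGeometry.Motives.AbelianVariety.linearIndependent_rationalTateModuleMap_hom_of_linearIndependent_int
    (hℓ : (ℓ : K) ≠ 0) {ι : Type*} {f : ι → (A ⟶ B)} (hf : LinearIndependent ℤ f) :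
    LinearIndependent ℚ_[ℓ] fun i => rationalTateModuleMap ℓ (f i) := by
  -- `1 ⊗ f_i` independent in `ℚ_ℓ ⊗_ℤ Hom_K(A, B)`
  have h1 : LinearIndependent ℚ_[ℓ] fun i => ((1 : ℚ_[ℓ]) ⊗ₜ[ℤ] f i) :=
    Module.Flat.linearIndependent_one_tmul hf
  -- through the injective rational Tate map
  have h2 := h1.map' (faltingsRationalTateMap A B ℓ)
    (LinearMap.ker_eq_bot.mpr (faltingsRationalTateMap_injective A B ℓ hℓ))
  -- forget the equivariance
  have h3 := h2.map' (Representation.IntertwiningMap.toLinearMapl (ρ := A.rationalTateRep ℓ) (σ := B.rationalTateRep ℓ))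
    (LinearMap.ker_eq_bot.mpr (Representation.IntertwiningMap.toLinearMap_injective _ _))
  have e : (Representation.IntertwiningMap.toLinearMapl (ρ := A.rationalTateRep ℓ) (σ := B.rationalTateRep ℓ)) ∘
      ((faltingsRationalTateMap A B ℓ) ∘ fun i => ((1 : ℚ_[ℓ]) ⊗ₜ[ℤ] f i)) =
        fun i => rationalTateModuleMap ℓ (f i) := by
    funext i
    simp only [Function.comp_apply, faltingsRationalTateMap_tmul, one_smul,
      Representation.IntertwiningMap.toLinearMapl_apply, toLinearMap_rationalTateIntertwiningMap]
  rw [e] at h3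
  exact h3

variable {A B} in
/-- An element of the image of the rational Tate map has underlying linear map in the `ℚ_ℓ`-span of the `V_ℓ f`,
`f ∈ Hom_K(A, B)` (pure tensors `c ⊗ f ↦ c • V_ℓ f` generate; over any field; the elementary half of the span reading of
Faltings' Korollar 1 ⊗ `ℚ_l`). [cite: Faltings1983Endlichkeit, §5 Korollar 1 and proof of Korollar 2] -/
theorem toLinearMap_mem_span_range_rationalTateModuleMap_of_mem_range {g : rationalTateHom A B ℓ}
    (hg : g ∈ LinearMap.range (faltingsRationalTateMap A B ℓ)) :
    g.toLinearMap ∈ Submodule.span ℚ_[ℓ] (Set.range (rationalTateModuleMap ℓ : (A ⟶ B) → _)) := by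
  obtain ⟨t, rfl⟩ := hg
  induction t using TensorProduct.induction_on with
  | zero => rw [map_zero, Representation.IntertwiningMap.zero_toLinearMap]; exact zero_mem _
  | tmul c f =>
    rw [faltingsRationalTateMap_tmul, Representation.IntertwiningMap.toLinearMap_smul, toLinearMap_rationalTateIntertwiningMap]
    exact Submodule.smul_mem _ c (Submodule.subset_span ⟨f, rfl⟩)
  | add x y hx hy =>
    rw [map_add, Representation.IntertwiningMap.add_toLinearMap]
    exact add_mem hx hy

variable {A B} in
/-- Conversely every `V_ℓ f` comes from the rational Tate map: `V_ℓ f = faltingsRationalTateMap (1 ⊗ f)` (over any field).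
[cite: Faltings1983Endlichkeit, §5 Korollar 1 and proof of Korollar 2] -/
theorem rationalTateIntertwiningMap_mem_range (f : A ⟶ B) :
    rationalTateIntertwiningMap ℓ f ∈ LinearMap.range (faltingsRationalTateMap A B ℓ) :=
  ⟨(1 : ℚ_[ℓ]) ⊗ₜ[ℤ] f, by rw [faltingsRationalTateMap_tmul, one_smul]⟩

variable {A B} in
/-- **Rational Faltings in span form** (consequence of `faltings_tate_bijective A B ℓ`, hypothesis `h`): over a number field, every
`Γ_K`-equivariant `ℚ_ℓ`-linear map `g : V_ℓ A → V_ℓ B` lies in the `ℚ_ℓ`-span of the maps `V_ℓ f`, `f ∈ Hom_K(A, B)` — the shape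
consumed by the `a3-liu418` S_F step (Liu 2021, proof of Thm. 4.18, «by Faltings … is Hom-isotypic»).  Rational analogue of
`mem_span_range_tateModuleMap_of_faltings_tate_bijective`. [cite: Faltings1983Endlichkeit, §5 Korollar 1 and proof of Korollar 2] -/
theorem mem_span_range_rationalTateModuleMap_of_faltings_tate_bijective
    (h : faltings_tate_bijective A B ℓ) [NumberField K]
    (g : A.rationalTateModule ℓ →ₗ[ℚ_[ℓ]] B.rationalTateModule ℓ)
    (hg : ∀ (σ : Field.absoluteGaloisGroup K) (v : A.rationalTateModule ℓ),
      g (A.rationalTateRep ℓ σ v) = B.rationalTateRep ℓ σ (g v)) :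
    g ∈ Submodule.span ℚ_[ℓ] (Set.range (rationalTateModuleMap ℓ : (A ⟶ B) → _)) := by
  obtain ⟨t, ht⟩ := (faltings_rationalTate_bijective_of A B ℓ h).2
    (g.intertwiningMap_of_isIntertwiningMap (A.rationalTateRep ℓ) (B.rationalTateRep ℓ) hg)
  exact toLinearMap_mem_span_range_rationalTateModuleMap_of_mem_range ℓ ⟨t, ht⟩

variable {A B} in
/-- **The span IS the space of intertwiners** (granted `faltings_tate_bijective A B ℓ`): a `ℚ_ℓ`-linear `g : V_ℓ A → V_ℓ B` is
`Γ_K`-equivariant iff it lies in the `ℚ_ℓ`-span of the `V_ℓ f`, `f ∈ Hom_K(A, B)` (the `V_ℓ f` are equivariant,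
`rationalTateRep_rationalTateModuleMap`, and spans of equivariant maps are equivariant).
[cite: Faltings1983Endlichkeit, §5 Korollar 1 and proof of Korollar 2] -/
theorem mem_span_range_rationalTateModuleMap_iff_of_faltings_tate_bijective
    (h : faltings_tate_bijective A B ℓ) [NumberField K]
    (g : A.rationalTateModule ℓ →ₗ[ℚ_[ℓ]] B.rationalTateModule ℓ) :
    g ∈ Submodule.span ℚ_[ℓ] (Set.range (rationalTateModuleMap ℓ : (A ⟶ B) → _)) ↔
      ∀ (σ : Field.absoluteGaloisGroup K) (v : A.rationalTateModule ℓ),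
        g (A.rationalTateRep ℓ σ v) = B.rationalTateRep ℓ σ (g v) := by
  refine ⟨fun hg σ => ?_, mem_span_range_rationalTateModuleMap_of_faltings_tate_bijective ℓ h g⟩
  refine Submodule.span_induction (p := fun g _ => ∀ v : A.rationalTateModule ℓ,
      g (A.rationalTateRep ℓ σ v) = B.rationalTateRep ℓ σ (g v)) ?_ (fun _ => by simp) (fun x y _ _ hx hy v => ?_)
    (fun c x _ hx v => ?_) hg
  · rintro _ ⟨f, rfl⟩ v
    exact rationalTateRep_rationalTateModuleMap ℓ f σ v
  · rw [LinearMap.add_apply, LinearMap.add_apply, hx, hy, map_add]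
  · rw [LinearMap.smul_apply, LinearMap.smul_apply, hx, map_smul]

/-- `Hom_{Γ_K}(V_ℓ A, V_ℓ B)` is a finite-dimensional `ℚ_ℓ`-vector space for `ℓ` invertible in `K` (a subspace of
`Hom_{ℚ_ℓ}(V_ℓ A, V_ℓ B)`, `dim V_ℓ = 2 dim < ∞` — Mumford §19 p. 172 «`V_ℓ(X)` is a `2g`-dimensional vector space over `ℚ_ℓ`»:
tree `module_finite_tateModule_of_cast_ne_zero` and Mathlib's `Module.Finite A (IntertwiningMap ρ σ)`).
[cite: MumfordAV1970, §19 p. 172] -/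
theorem _root_.Literature.AlgebraicGeometry.Motives.AbelianVariety.module_finite_rationalTateHom (hℓ : (ℓ : K) ≠ 0) :
    Module.Finite ℚ_[ℓ] (rationalTateHom A B ℓ) := by
  haveI : Module.Finite ℤ_[ℓ] (A.tateModule ℓ) := module_finite_tateModule_of_cast_ne_zero A ℓ hℓ
  haveI : Module.Finite ℤ_[ℓ] (B.tateModule ℓ) := module_finite_tateModule_of_cast_ne_zero B ℓ hℓ
  haveI : Module.Finite ℚ_[ℓ] (A.rationalTateModule ℓ) :=
    inferInstanceAs (Module.Finite ℚ_[ℓ] (ℚ_[ℓ] ⊗[ℤ_[ℓ]] A.tateModule ℓ))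
  haveI : Module.Finite ℚ_[ℓ] (B.rationalTateModule ℓ) :=
    inferInstanceAs (Module.Finite ℚ_[ℓ] (ℚ_[ℓ] ⊗[ℤ_[ℓ]] B.tateModule ℓ))
  infer_instance

/-- **Rank form of rational Faltings** (granted `faltings_tate_bijective A B ℓ`): over a number field,
`dim_{ℚ_ℓ} Hom_{Γ_K}(V_ℓ A, V_ℓ B) = rank_ℤ Hom_K(A, B)` (`Hom_K(A, B)` is a finite free `ℤ`-module — tree theorems
`module_free_hom_holds` / `module_finite_hom_holds`, Mumford §19 Thm. 3 — so `dim_{ℚ_ℓ} ℚ_ℓ ⊗_ℤ Hom = rank_ℤ Hom`, and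
`faltingsRationalTateEquiv_of`). [cite: Faltings1983Endlichkeit, §5 Korollar 1 and proof of Korollar 2] -/
theorem finrank_rationalTateHom_eq_of (h : faltings_tate_bijective A B ℓ) [NumberField K] :
    Module.finrank ℚ_[ℓ] (rationalTateHom A B ℓ) = Module.finrank ℤ (A ⟶ B) := by
  haveI : Module.Free ℤ (A ⟶ B) := module_free_hom_holds A B
  haveI : Module.Finite ℤ (A ⟶ B) := module_finite_hom_holds A B
  rw [← (faltingsRationalTateEquiv_of A B ℓ h).finrank_eq, Module.finrank_baseChange]

end Consequences

end Literature.AlgebraicGeometry.Motives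

end
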